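import Summits.PneNP.PneNP.Theorems.SymmetryBudgetNoHiddenOrderPerPathCGPointer

/-!
# Decoding by pointer consensus: the certified scheme on the Corneil–Goldberg process is complete for every decoding that is right on the solution subtree

Route `PneNP/SymmetryBudget`, `NoHiddenOrder` (stmt-PneNP-14781). The value `CertifiedLabels.val P V dec adm g L` of a label group is defined for an
ARBITRARY decoding map `dec : Label → Option Inst`; soundness (`cg_val_sound`) holds for every `dec`, and completeness only consumes `dec` on the labels
of the solution subtree (`CertifiedLabels.val_complete`). The generic decoding `CertifiedLabels.replay` follows "the" lineage of a label, which a
symmetric circuit cannot do; what the (R2c) circuit computes are the RUNS OF POINTERS (`…ReplayRoot.stateReads_replay_root`). Here: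

* `cg_val_ne_none_of_reach_dec`, `cg_root_good_dec` (ANY valuation), `cg_root_value_dec` (the realised valuation) — completeness and the root value
  for ANY decoding that returns the reached instance on every label of the solution subtree (selector `cgSel`, values `hgt`, admissibility
  `BudgetBound`, value range `|V|`); a compiler may thus choose a circuit-native value type and decoding and only has to check `hdec`;
* `ptrDec G I₀ F` — the POINTER-CONSENSUS decoding: `(U, X, λ) ↦ (U, c)` when `U ≠ ∅` and the runs `replay G X λ v F (St G I₀ v)` of all pointers
  `v ∈ U` end with one and the same colouring `c` (a symmetric function of the family of runs; `ptrDec_eq_some_iff`, `ptrDec_isSome_iff`);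
* `ptrDec_reach` — by the pointer bridge (`reach_replay_snd_eq`) it is right on the solution subtree for `F ≥ |V|`, hence
  `cg_root_good_ptrDec` / `cg_root_value_ptrDec` / `cg_root_value_ptrDec_refineIn`: **the budgeted certified scheme decoded by pointer consensus
  outputs at the root a copy of the start block** — every ingredient of this statement is a per-pointer replay, a switching/refinement step or a finite comparison;
* `ptrDec_part_of_mem_cgParts` — with this decoding the certification of PARTS in `val` is automatic (a part of a decoded instance decodes to
  itself), so only candidate children need a run-time certificate.
-/

-- `Summit.PneNP.PneNP.…` duplicates `PneNP` BY DESIGN (single-problem summit, D-0017 layout).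
set_option linter.dupNamespace false

namespace Summit.PneNP.PneNP.Theorems

open Finset

namespace BranchSum

variable {V : Type*} [Fintype V] [DecidableEq V] {G : SimpleGraph V} [DecidableRel G.Adj] {I₀ : CGInst V}

/-! ### Completeness for any decoding right on the solution subtree (any valuation) -/

/-- **Completeness for an arbitrary decoding and an arbitrary valuation**: if `dec` returns the reached instance on every label of the solution
subtree (selector `cgSel`, values the heights) and these labels are admissible, every group of the solution subtree outputs a value (value range
`|V|`). -/
theorem cg_val_ne_none_of_reach_dec {Val : Type*} [DecidableEq Val] (Vl : CertifiedLabels.Valuation (cgProcess G) Val)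
    (dec : CertifiedLabels.Label V → Option (CGInst V))
    (hdec : ∀ (I : CGInst V) X lam, CertifiedLabels.Reach (cgProcess G) (cgSel (V := V)) (hgt G cgSel) I₀ I X lam → dec ⟨I.1.1, X, lam⟩ = some I)
    (adm : CertifiedLabels.Label V → Prop)
    (hadm : ∀ (I : CGInst V) X lam, CertifiedLabels.Reach (cgProcess G) (cgSel (V := V)) (hgt G cgSel) I₀ I X lam → adm ⟨I.1.1, X, lam⟩)
    (I : CGInst V) (X : Finset V) (lam : V → ℕ)
    (h : CertifiedLabels.Reach (cgProcess G) (cgSel (V := V)) (hgt G cgSel) I₀ I X lam) :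
    CertifiedLabels.val (cgProcess G) Vl dec adm (Fintype.card V) ⟨I.1.1, X, lam⟩ ≠ none := by
  refine CertifiedLabels.val_complete (cgProcess G) Vl dec adm _ (cgSel (V := V)) (hgt G cgSel) I₀ cgSel_mem
    (fun I _ _ _ => hgt_cgSel_lt_card I) (fun I A ch hs => ?_) hdec (fun I X lam A ch hR hs => ?_) hadm I X lam h
  · obtain ⟨-, -, -, rfl⟩ := cgStep_eq_orNode_iff.1 hs
    rfl
  · exact cgSel_fresh cgSel_mem I X lam A ch hR hs

/-- **The root group outputs a good value, for an arbitrary decoding right on the solution subtree and an arbitrary valuation** (budgeted scheme,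
equitable start). -/
theorem cg_root_good_dec {Val : Type*} [DecidableEq Val] (Vl : CertifiedLabels.Valuation (cgProcess G) Val)
    (hI₀ : ∀ u ∈ I₀.1.1, ∀ u' ∈ I₀.1.1, I₀.1.2 u = I₀.1.2 u' → ∀ w ∈ I₀.1.1,
      ((cellOf I₀.1.1 I₀.1.2 w).filter fun y => G.Adj u y).card = ((cellOf I₀.1.1 I₀.1.2 w).filter fun y => G.Adj u' y).card)
    (dec : CertifiedLabels.Label V → Option (CGInst V))
    (hdec : ∀ (I : CGInst V) X lam, CertifiedLabels.Reach (cgProcess G) (cgSel (V := V)) (hgt G cgSel) I₀ I X lam → dec ⟨I.1.1, X, lam⟩ = some I) :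
    ∃ v : Val, CertifiedLabels.val (cgProcess G) Vl dec (fun L => BudgetBound L.X L.lam) (Fintype.card V) ⟨I₀.1.1, ∅, fun _ => 0⟩ = some v ∧
      Vl.Good I₀ v := by
  have hne := cg_val_ne_none_of_reach_dec Vl dec hdec (fun L => BudgetBound L.X L.lam) (fun I X lam h => reach_budgetBound hI₀ h) I₀ ∅
    (fun _ => 0) CertifiedLabels.Reach.root
  obtain ⟨v, hv⟩ := Option.ne_none_iff_exists'.1 hne
  refine ⟨v, hv, ?_⟩
  obtain ⟨I, hI, hgood⟩ := CertifiedLabels.val_sound (cgProcess G) Vl dec _ _ _ v hv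
  rw [hdec I₀ ∅ (fun _ => 0) CertifiedLabels.Reach.root] at hI
  cases hI
  exact hgood

/-- **The root value for an arbitrary decoding right on the solution subtree** (realised valuation `cgValuation`, budgeted scheme, equitable
start): it exists and is the copy of the start block read along an enumeration. -/
theorem cg_root_value_dec
    (hI₀ : ∀ u ∈ I₀.1.1, ∀ u' ∈ I₀.1.1, I₀.1.2 u = I₀.1.2 u' → ∀ w ∈ I₀.1.1,
      ((cellOf I₀.1.1 I₀.1.2 w).filter fun y => G.Adj u y).card = ((cellOf I₀.1.1 I₀.1.2 w).filter fun y => G.Adj u' y).card)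
    (dec : CertifiedLabels.Label V → Option (CGInst V))
    (hdec : ∀ (I : CGInst V) X lam, CertifiedLabels.Reach (cgProcess G) (cgSel (V := V)) (hgt G cgSel) I₀ I X lam → dec ⟨I.1.1, X, lam⟩ = some I) :
    ∃ E : Enc, CertifiedLabels.val (cgProcess G) (cgValuation G) dec (fun L => BudgetBound L.X L.lam) (Fintype.card V) ⟨I₀.1.1, ∅, fun _ => 0⟩ =
        some E ∧ ∃ l : List V, l.Nodup ∧ l.toFinset = I₀.1.1 ∧ E = encOf G I₀.1.2 l :=
  cg_root_good_dec (cgValuation G) hI₀ dec hdec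

/-! ### The pointer-consensus decoding -/

variable (G I₀)

/-- **POINTER-CONSENSUS DECODING** with fuel `F`: the label `(U, X, λ)` decodes to `(U, c)` when `U` is non-empty and the runs of all pointers
`v ∈ U` — `replay G X λ v F (St G I₀ v)` — end with the same colouring `c`; otherwise it does not decode. (The `choose` only names the common
value; `ptrDec_eq_some_iff` is the choice-free characterisation.) -/
noncomputable def ptrDec (F : ℕ) (L : CertifiedLabels.Label V) : Option (CGInst V) :=
  if h : L.U.Nonempty ∧ ∀ v ∈ L.U, ∀ w ∈ L.U, (replay G L.X L.lam v F (St G I₀ v)).2 = (replay G L.X L.lam w F (St G I₀ w)).2 then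
    some ⟨(L.U, (replay G L.X L.lam h.1.choose F (St G I₀ h.1.choose)).2), h.1⟩
  else none

variable {G I₀}

/-- **What the consensus decoding returns**: `(U, X, λ)` decodes to `I` iff `I` has block `U` and every pointer of `U` runs to the colouring of `I`. -/
theorem ptrDec_eq_some_iff {F : ℕ} {L : CertifiedLabels.Label V} {I : CGInst V} :
    ptrDec G I₀ F L = some I ↔ I.1.1 = L.U ∧ ∀ v ∈ L.U, (replay G L.X L.lam v F (St G I₀ v)).2 = I.1.2 := by
  constructor
  · intro h
    unfold ptrDec at h
    split_ifs at h with hc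
    rw [Option.some.injEq] at h
    subst h
    exact ⟨rfl, fun v hv => hc.2 v hv _ hc.1.choose_spec⟩
  · rintro ⟨hU, hcol⟩
    have hc : L.U.Nonempty ∧ ∀ v ∈ L.U, ∀ w ∈ L.U, (replay G L.X L.lam v F (St G I₀ v)).2 = (replay G L.X L.lam w F (St G I₀ w)).2 :=
      ⟨hU ▸ I.2, fun v hv w hw => (hcol v hv).trans (hcol w hw).symm⟩
    unfold ptrDec
    rw [dif_pos hc, Option.some.injEq]
    exact Subtype.ext (Prod.ext hU.symm (hcol _ hc.1.choose_spec))

/-- The label decodes iff its block is non-empty and its pointers' runs agree on the final colouring. -/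
theorem ptrDec_isSome_iff {F : ℕ} {L : CertifiedLabels.Label V} :
    (ptrDec G I₀ F L).isSome ↔
      L.U.Nonempty ∧ ∀ v ∈ L.U, ∀ w ∈ L.U, (replay G L.X L.lam v F (St G I₀ v)).2 = (replay G L.X L.lam w F (St G I₀ w)).2 := by
  unfold ptrDec
  split_ifs with hc
  · simp only [Option.isSome_some, true_iff]; exact hc
  · simp only [Option.isSome_none, Bool.false_eq_true, false_iff]; exact hc

/-- **The consensus decoding is right on the solution subtree** (fuel `≥ |V|`): the pointer bridge `reach_replay_snd_eq`. -/
theorem ptrDec_reach {I : (cgProcess G).Inst} {X : Finset V} {lam : V → ℕ}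
    (h : CertifiedLabels.Reach (cgProcess G) (cgSel (V := V)) (hgt G cgSel) I₀ I X lam) {F : ℕ} (hF : Fintype.card V ≤ F) :
    ptrDec G I₀ F ⟨I.1.1, X, lam⟩ = some I :=
  ptrDec_eq_some_iff.2 ⟨rfl, fun _ hv => reach_replay_snd_eq h hv hF⟩

/-- **Parts certify automatically**: if `L` decodes to `I`, the part label of every switching component of `I` decodes to that part. -/
theorem ptrDec_part_of_mem_cgParts {F : ℕ} {L : CertifiedLabels.Label V} {I : CGInst V} (h : ptrDec G I₀ F L = some I) {J : CGInst V}
    (hJ : J ∈ cgParts G I) : ptrDec G I₀ F (L.part J.1.1) = some J := by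
  obtain ⟨hcolJ, hK⟩ := mem_cgParts_iff.1 hJ
  obtain ⟨hU, hcol⟩ := ptrDec_eq_some_iff.1 h
  obtain ⟨w, -, hKw⟩ := mem_image.1 hK
  refine ptrDec_eq_some_iff.2 ⟨rfl, fun v hv => ?_⟩
  rw [hcolJ]
  exact hcol v (hU ▸ swReach_subset _ _ w (hKw ▸ hv))

/-- More generally any non-empty sub-block decodes, with the same colouring. -/
theorem ptrDec_part {F : ℕ} {L : CertifiedLabels.Label V} {I : CGInst V} (h : ptrDec G I₀ F L = some I) {K : Finset V}
    (hK : K.Nonempty) (hKU : K ⊆ L.U) : ptrDec G I₀ F (L.part K) = some ⟨(K, I.1.2), hK⟩ := by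
  obtain ⟨-, hcol⟩ := ptrDec_eq_some_iff.1 h
  exact ptrDec_eq_some_iff.2 ⟨rfl, fun v hv => hcol v (hKU hv)⟩

/-! ### The root value with the consensus decoding -/

/-- **The root group of the budgeted scheme decoded by pointer consensus outputs a good value** — for any valuation (equitable start, fuel `≥ |V|`). -/
theorem cg_root_good_ptrDec {Val : Type*} [DecidableEq Val] (Vl : CertifiedLabels.Valuation (cgProcess G) Val)
    (hI₀ : ∀ u ∈ I₀.1.1, ∀ u' ∈ I₀.1.1, I₀.1.2 u = I₀.1.2 u' → ∀ w ∈ I₀.1.1,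
      ((cellOf I₀.1.1 I₀.1.2 w).filter fun y => G.Adj u y).card = ((cellOf I₀.1.1 I₀.1.2 w).filter fun y => G.Adj u' y).card)
    {F : ℕ} (hF : Fintype.card V ≤ F) :
    ∃ v : Val, CertifiedLabels.val (cgProcess G) Vl (ptrDec G I₀ F) (fun L => BudgetBound L.X L.lam) (Fintype.card V) ⟨I₀.1.1, ∅, fun _ => 0⟩ =
      some v ∧ Vl.Good I₀ v :=
  cg_root_good_dec Vl hI₀ (ptrDec G I₀ F) fun _ _ _ h => ptrDec_reach h hF

/-- **The budgeted certified scheme decoded by pointer consensus outputs a copy of the start block at the root** (realised valuation, equitable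
start, fuel `≥ |V|`). -/
theorem cg_root_value_ptrDec
    (hI₀ : ∀ u ∈ I₀.1.1, ∀ u' ∈ I₀.1.1, I₀.1.2 u = I₀.1.2 u' → ∀ w ∈ I₀.1.1,
      ((cellOf I₀.1.1 I₀.1.2 w).filter fun y => G.Adj u y).card = ((cellOf I₀.1.1 I₀.1.2 w).filter fun y => G.Adj u' y).card)
    {F : ℕ} (hF : Fintype.card V ≤ F) :
    ∃ E : Enc, CertifiedLabels.val (cgProcess G) (cgValuation G) (ptrDec G I₀ F) (fun L => BudgetBound L.X L.lam) (Fintype.card V)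
        ⟨I₀.1.1, ∅, fun _ => 0⟩ = some E ∧ ∃ l : List V, l.Nodup ∧ l.toFinset = I₀.1.1 ∧ E = encOf G I₀.1.2 l :=
  cg_root_value_dec hI₀ (ptrDec G I₀ F) fun _ _ _ h => ptrDec_reach h hF

/-- The same from a block `W` with the refinement of any start colouring `λ₀` (for the window: `V` the window type, `W = univ` or a sub-block,
`λ₀` the signature ranks): the root group outputs a copy of `(W, refineIn G W λ₀)`. -/
theorem cg_root_value_ptrDec_refineIn {W : Finset V} (hW : W.Nonempty) (lam₀ : V → ℕ) {F : ℕ} (hF : Fintype.card V ≤ F) :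
    ∃ E : Enc, CertifiedLabels.val (cgProcess G) (cgValuation G) (ptrDec G ⟨(W, refineIn G W lam₀), hW⟩ F) (fun L => BudgetBound L.X L.lam)
        (Fintype.card V) ⟨W, ∅, fun _ => 0⟩ = some E ∧ ∃ l : List V, l.Nodup ∧ l.toFinset = W ∧ E = encOf G (refineIn G W lam₀) l :=
  cg_root_value_ptrDec (I₀ := ⟨(W, refineIn G W lam₀), hW⟩) (fun _ hu _ hu' huu' _ hw => equitableIn_refineIn W lam₀ hu hu' huu' hw) hF

end BranchSum

end Summit.PneNP.PneNP.Theorems
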